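import Summits.ABC.IUTFork.Repair.ModelShellDep
import HarnessLib

/-!
# REPAIR branch — ENGINE REQUEST E3, part II: the PROFILE of the label-dependent log-shell family and THE E3 ANSWER

Continuation of `Repair/ModelShellDep.lean` (same seat abc-iut-w5-d098, same GO: rp-plan RULINGS #10 (3) / #11); proof-only (two toy inflation
vectors `dStar`, `dZero` as `def`s). See the module docstring of part I for the family, the profile and the reading of the E3 answer:
S `↔ d 0 = 0 ∧ d 1 = 0 ∧ d 2 = 3`; M32b `H′ ↔ d 1 = 0 ∧ d 2 = 3`; `H′ ∧ ¬S` only by inflating the ZERO label; at `d⃗⋆ = (0,0,3)` the residual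
itself holds honest-except-`hscaled`@`j = 2`. TAKES NO SIDE; models are test objects; typed ≠ proved. [claim: Mochizuki2012, status: disputed]
-/

noncomputable section

open Set

namespace Summit.ABC.IUTFork.Repair.ModelShellDep

open Thm311 Cor312 Cor312.Checks Cor312.IdentifiedNonVacuity Cor312Vol Cor312Vol.NaiveWitness Cor312Vol.PinnedWitness
  Cor312Vol.PinnedHonest Literature.IUT.LogThetaLattice
open Summit.ABC.IUTFork.Repair.CandMochizuki32

variable (p : ℕ) (d : toyIndex.Label → ℕ) [hp : Fact p.Prime]

/-! ## 5. The residual S, Reading R3, GapA3/GapH3, and the M32 readings on the family -/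

omit hp d in
/-- Enumeration of the three labels. [folklore] -/
theorem forall_label_iff (Q : toyIndex.Label → Prop) : (∀ j, Q j) ↔ Q 0 ∧ Q 1 ∧ Q 2 :=
  ⟨fun h => ⟨h 0, h 1, h 2⟩, fun h j => by fin_cases j <;> [exact h.1; exact h.2.1; exact h.2.2]⟩

/-- **Reading R3 at ALL labels ⟺ `d 0 = 0 ∧ d 1 = 0 ∧ d 2 = 3`** (`B_0 = B_{−d 0}`, `B_1 = B_{1 − d 1}`, `B_1 = B_{4 − d 2}`). [folklore] -/
theorem dep_reading3_iff :
    (∀ (j : toyIndex.Label) (vQ : toyIndex.VQ), (shellSettingDep p d).qRegion j vQ ∈ (shellSettingDep p d).possibleImages j vQ) ↔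
      d 0 = 0 ∧ d 1 = 0 ∧ d 2 = 3 := by
  have key : ∀ j : toyIndex.Label, (∀ vQ : toyIndex.VQ, (shellSettingDep p d).qRegion j vQ ∈ (shellSettingDep p d).possibleImages j vQ) ↔
      (if j = 0 then (0 : ℤ) else 1) = jsq j - d j := by
    intro j
    constructor
    · intro h
      have h1 := h ()
      rw [dep_possibleImages, Set.mem_singleton_iff] at h1
      by_cases hj : j = 0
      · subst hj; rw [if_pos rfl]; rw [show (shellSettingDep p d).qRegion 0 () = pBall p 0 () 0 from pinnedSetting_qRegion_zero p ()] at h1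
        exact pBall_injective p _ () h1
      · rw [if_neg hj]; rw [show (shellSettingDep p d).qRegion j () = pBall p j () 1 from pinnedSetting_qRegion_of_ne_zero p hj ()] at h1
        exact pBall_injective p _ () h1
    · intro h vQ
      rw [dep_possibleImages, Set.mem_singleton_iff]
      by_cases hj : j = 0
      · subst hj; rw [if_pos rfl] at h
        rw [show (shellSettingDep p d).qRegion 0 vQ = pBall p 0 vQ 0 from pinnedSetting_qRegion_zero p vQ, h]
      · rw [if_neg hj] at h
        rw [show (shellSettingDep p d).qRegion j vQ = pBall p j vQ 1 from pinnedSetting_qRegion_of_ne_zero p hj vQ, h]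
  rw [forall_label_iff, key, key, key]
  have e0 : jsq (0 : toyIndex.Label) = 0 := by decide
  have e1 : jsq (1 : toyIndex.Label) = 1 := by decide
  have e2 : jsq (2 : toyIndex.Label) = 4 := by decide
  simp only [e0, e1, e2, if_true, show (1 : toyIndex.Label) ≠ 0 by decide, show (2 : toyIndex.Label) ≠ 0 by decide, if_false]
  omega

/-- **THE RESIDUAL on the family: `S ↔ d 0 = 0 ∧ d 1 = 0 ∧ d 2 = 3`** (pins + Thm 3.11 (ii)(b): S ⟺ R3 at all labels, abc-iut-w5-d230
`reading3_iff_pilotKummerIndRelated`). [claim: Mochizuki2012, status: disputed] -/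
theorem dep_residual_iff :
    PilotKummerIndRelated (naiveFull p).toLatticeSituation (shellSettingDep p d) (rhoDep p d) (qDatum p) ↔ d 0 = 0 ∧ d 1 = 0 ∧ d 2 = 3 := by
  rw [← dep_reading3_iff p d]
  exact (reading3_iff_pilotKummerIndRelated _ _ _ _ (GluedMonoids.Naive.naive_kummerB p (shellSettingDep p d).n) (dep_pinnedRegions3 p d).1).symm

/-- `GapA3 ↔` the same condition (the pins hold, so `GapA3 ↔ R3`). [folklore] -/
theorem dep_gapA3_iff : GapA3 (naiveFull p).toLatticeSituation (shellSettingDep p d) (rhoDep p d) (qDatum p) ↔ d 0 = 0 ∧ d 1 = 0 ∧ d 2 = 3 :=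
  ⟨fun h => (dep_reading3_iff p d).1 (h (dep_pinnedRegions3 p d)), fun h _ => (dep_reading3_iff p d).2 h⟩

/-- `GapH3 ↔ 3 ≤ d 2` (pins hold, so `GapH3 ↔ Licence`). [folklore] -/
theorem dep_gapH3_iff : GapH3 (naiveFull p).toLatticeSituation (shellSettingDep p d) (rhoDep p d) (qDatum p) ↔ 3 ≤ d 2 :=
  ⟨fun h => (dep_licence_iff p d).1 (h (dep_pinnedRegions3 p d)), fun h _ => (dep_licence_iff p d).2 h⟩

/-- **M32a on the family**: rp-m3's REGION-level `CandMochizuki32.H` (= R3 at all labels) `↔ d 0 = 0 ∧ d 1 = 0 ∧ d 2 = 3` (= S).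
[claim: Mochizuki2012, status: disputed] -/
theorem dep_H_iff : H (naiveFull p).toLatticeSituation (shellSettingDep p d) (rhoDep p d) (qDatum p) ↔ d 0 = 0 ∧ d 1 = 0 ∧ d 2 = 3 := by
  rw [H_iff_reading3]; exact dep_reading3_iff p d

/-- **M32b on the family**: rp-m3's VOLUME-level `CandMochizuki32.H'` `↔ d 1 = 0 ∧ d 2 = 3` — NO condition at the zero label (H′ reads the
labels of `𝔽_l^⋇` only). [claim: Mochizuki2012, status: disputed] -/
theorem dep_H'_iff : H' (naiveFull p).toLatticeSituation (shellSettingDep p d) (rhoDep p d) (qDatum p) ↔ d 1 = 0 ∧ d 2 = 3 := by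
  have hl := log_p_pos p
  have key : ∀ i : Fin toyIndex.lstar,
      (∀ vQ : toyIndex.VQ, ∃ U ∈ (shellSettingDep p d).possibleImages (Setting.labelSucc i) vQ,
        (shellSettingDep p d).qLocal (Setting.labelSucc i) vQ = ((naiveFull p).toLatticeSituation.D (shellSettingDep p d).n).logvol _ vQ U) ↔
      (1 : ℤ) = jsq (Setting.labelSucc i) - d (Setting.labelSucc i) := by
    intro i
    constructor
    · intro h
      obtain ⟨U, hU, hv⟩ := h ()
      rw [dep_possibleImages, Set.mem_singleton_iff] at hU
      subst hU
      rw [dep_qLocal] at hv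
      change -Real.log p = pVol p _ () (pBall p _ () (jsq (Setting.labelSucc i) - d (Setting.labelSucc i))) at hv
      rw [pVol_pBall] at hv
      have : ((1 : ℤ) : ℝ) = ((jsq (Setting.labelSucc i) - d (Setting.labelSucc i) : ℤ) : ℝ) := by
        have := mul_right_cancel₀ hl.ne' (show ((1 : ℤ) : ℝ) * Real.log p = _ * Real.log p by push_cast; linarith)
        exact this
      exact_mod_cast this
    · intro h vQ
      refine ⟨pBall p _ vQ (jsq (Setting.labelSucc i) - d (Setting.labelSucc i)), by rw [dep_possibleImages, Set.mem_singleton_iff], ?_⟩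
      rw [dep_qLocal]
      change -Real.log p = pVol p _ vQ (pBall p _ vQ (jsq (Setting.labelSucc i) - d (Setting.labelSucc i)))
      rw [pVol_pBall, ← h]; push_cast; ring
  unfold H'
  rw [show (∀ (i : Fin toyIndex.lstar) (vQ : toyIndex.VQ), ∃ U ∈ (shellSettingDep p d).possibleImages (Setting.labelSucc i) vQ,
      (shellSettingDep p d).qLocal (Setting.labelSucc i) vQ = ((naiveFull p).toLatticeSituation.D (shellSettingDep p d).n).logvol _ vQ U) ↔
      ∀ i : Fin toyIndex.lstar, (1 : ℤ) = jsq (Setting.labelSucc i) - d (Setting.labelSucc i) from forall_congr' key]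
  rw [forall_labelFin_iff, labelSucc_fin_zero, labelSucc_fin_one]
  have e1 : jsq (1 : toyIndex.Label) = 1 := by decide
  have e2 : jsq (2 : toyIndex.Label) = 4 := by decide
  rw [e1, e2]
  omega

/-- **M32c on the family**: rp-m3's HULL-level `CandMochizuki32.H''` (q-region ⊆ hull at ALL labels) `↔ 3 ≤ d 2` (at the zero label `B_0 ⊆ B_{−d 0}`
always; at `j = 1` `B_1 ⊆ B_{1−d 1}` always). [claim: Mochizuki2012, status: disputed] -/
theorem dep_H''_iff : H'' (naiveFull p).toLatticeSituation (shellSettingDep p d) (rhoDep p d) (qDatum p) ↔ 3 ≤ d 2 := by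
  rw [H''_iff_subset_hull]
  constructor
  · intro h
    exact (dep_licence_iff p d).1 fun i vQ => h _ vQ
  · intro hd j vQ
    by_cases hj : j = 0
    · subst hj
      rw [(dep_thetaHull p d 0 vQ).1, show (shellSettingDep p d).qRegion 0 vQ = pBall p 0 vQ 0 from pinnedSetting_qRegion_zero p vQ,
        pBall_subset_iff]
      have : jsq (0 : toyIndex.Label) = 0 := by decide
      rw [this]; omega
    · obtain ⟨i, rfl⟩ := Fin.exists_succ_eq.mpr hj
      exact (dep_licence_iff p d).2 hd i vQ

/-- **On the family `H′ ∧ ¬S ↔ (d 1 = 0 ∧ d 2 = 3 ∧ d 0 ≠ 0)`**: the volume-level reading can be separated from the residual here ONLY by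
inflating the ZERO label. [folklore] -/
theorem dep_H'_and_not_S_iff :
    (H' (naiveFull p).toLatticeSituation (shellSettingDep p d) (rhoDep p d) (qDatum p) ∧
      ¬ PilotKummerIndRelated (naiveFull p).toLatticeSituation (shellSettingDep p d) (rhoDep p d) (qDatum p)) ↔
      d 1 = 0 ∧ d 2 = 3 ∧ d 0 ≠ 0 := by
  rw [dep_H'_iff, dep_residual_iff]
  tauto

/-! ## 6. THE E3 ANSWER -/

/-- The E3 point `d⃗⋆ = (0, 0, 3)` — inflation `j² − 1` on `𝔽_l^⋇`, none at the zero label. [folklore] -/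
def dStar : toyIndex.Label → ℕ := fun j => if j = 2 then 3 else 0

omit hp in
/-- Values of `d⃗⋆`. [folklore] -/
theorem dStar_vals : dStar 0 = 0 ∧ dStar 1 = 0 ∧ dStar 2 = 3 := by refine ⟨?_, ?_, ?_⟩ <;> decide

/-- **E3 (a): THE RESIDUAL WITNESS at `d⃗⋆`.** Typed Thm 3.11 ∧ BridgeHyps ∧ `|log q| > 0` ∧ PinnedRegions3 (ONE (Ind3)-aware operator) ∧ Step (x)
∧ admissible (Ind3)-regions ∧ label-independent q-volume ∧ `H′` (M32b) ∧ `H` (M32a) ∧ **S** ∧ `GapH3` ∧ the typed Corollary ALL HOLD at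
`shellSettingDep p d⃗⋆`, for the NON-identified datum `qDatum p ≠ Ψ` — with honest `j²`-scaling HOLDING at `j = 1` and FAILING at `j = 2`
(the only violated honesty clause). A SAT[ρ, label-dependent (Ind3)] witness for the residual itself ((Ind)-trivial class).
[claim: Mochizuki2012, status: disputed] -/
theorem E3_residual_witness :
    (naiveFull p).Statement ∧ BridgeHyps (shellSettingDep p dStar) ∧ (shellSettingDep p dStar).AbsLogQPos ∧
    PinnedRegions3 (naiveFull p).toLatticeSituation (shellSettingDep p dStar) (rhoDep p dStar) (qDatum p) ∧
    (∀ Φ ∈ signShells.Ind1Family ∪ signShells.Ind2Family, ∀ (j : toyIndex.Label) (vQ : toyIndex.VQ) (B : Set (signShells.Packet j vQ)),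
      ((naiveFull p).toLatticeSituation.D (shellSettingDep p dStar).n).Adm j vQ B ↔
        ((naiveFull p).toLatticeSituation.D (shellSettingDep p dStar).n).Adm j vQ (Φ j vQ '' B)) ∧
    ((naiveFull p).toLatticeSituation.D (shellSettingDep p dStar).n).LogvolInvariant ∧
    (∀ (j : toyIndex.Label) (vQ : toyIndex.VQ),
      ((naiveFull p).toLatticeSituation.D (shellSettingDep p dStar).n).Adm j vQ ((shellSettingDep p dStar).thetaRegion3 j vQ)) ∧
    (∀ (i i' : Fin toyIndex.lstar) (vQ : toyIndex.VQ),
      (shellSettingDep p dStar).qLocal (Setting.labelSucc i) vQ = (shellSettingDep p dStar).qLocal (Setting.labelSucc i') vQ) ∧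
    H' (naiveFull p).toLatticeSituation (shellSettingDep p dStar) (rhoDep p dStar) (qDatum p) ∧
    H (naiveFull p).toLatticeSituation (shellSettingDep p dStar) (rhoDep p dStar) (qDatum p) ∧
    PilotKummerIndRelated (naiveFull p).toLatticeSituation (shellSettingDep p dStar) (rhoDep p dStar) (qDatum p) ∧
    GapH3 (naiveFull p).toLatticeSituation (shellSettingDep p dStar) (rhoDep p dStar) (qDatum p) ∧
    Summit.ABC.IUTFork.Cor312.Setting.Statement (shellSettingDep p dStar) ∧
    PinnedWitness.qDatum p ≠ (fun v _ => Psi p v) ∧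
    (((naiveFull p).toLatticeSituation.D (shellSettingDep p dStar).n).logvol _ ()
        (rhoDep p dStar ((naiveFull p).toLatticeSituation.D (shellSettingDep p dStar).n).Ψ (Setting.labelSucc ⟨0, by decide⟩) ()) =
      ((((⟨0, by decide⟩ : Fin toyIndex.lstar) : ℕ) + 1 : ℕ) : ℝ) ^ 2 * (shellSettingDep p dStar).qLocal (Setting.labelSucc ⟨0, by decide⟩) ()) ∧
    ¬ (((naiveFull p).toLatticeSituation.D (shellSettingDep p dStar).n).logvol _ ()
        (rhoDep p dStar ((naiveFull p).toLatticeSituation.D (shellSettingDep p dStar).n).Ψ (Setting.labelSucc ⟨1, by decide⟩) ()) =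
      ((((⟨1, by decide⟩ : Fin toyIndex.lstar) : ℕ) + 1 : ℕ) : ℝ) ^ 2 * (shellSettingDep p dStar).qLocal (Setting.labelSucc ⟨1, by decide⟩) ()) := by
  have hv := dStar_vals
  refine ⟨naiveFull_statement p, dep_bridgeHyps p _, dep_absLogQPos p _, dep_pinnedRegions3 p _, dep_adm_iff_image p _,
    dep_logvolInvariant p _, dep_thetaRegion3_adm p _, dep_qLocal_indep p _, (dep_H'_iff p _).2 ⟨hv.2.1, hv.2.2⟩,
    (dep_H_iff p _).2 hv, (dep_residual_iff p _).2 hv, (dep_gapH3_iff p _).2 hv.2.2.ge, (dep_statement_iff p _).2 (by rw [hv.2.1, hv.2.2]),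
    ?_, ?_, ?_⟩
  · intro h
    exact not_isThetaType_qDatum p (h ▸ isThetaType_Psi p)
  · rw [dep_hscaled_iff, labelSucc_fin_zero]; exact hv.2.1
  · rw [dep_hscaled_iff, labelSucc_fin_one]; rw [hv.2.2]; decide

/-- **E3 (b): NO HONEST-LABEL SEPARATION on the family.** If `H′` holds and S fails at `shellSettingDep p d⃗` (with `rhoDep d⃗`, `qDatum`), then
the zero label is inflated (`d 0 ≠ 0`) while `d 1 = 0`, `d 2 = 3`: S fails ONLY at `j = 0`, where neither `H′`, nor the Licence, nor the typed
Corollary reads anything. [folklore] -/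
theorem E3_no_honest_separation
    (hH : H' (naiveFull p).toLatticeSituation (shellSettingDep p d) (rhoDep p d) (qDatum p))
    (hS : ¬ PilotKummerIndRelated (naiveFull p).toLatticeSituation (shellSettingDep p d) (rhoDep p d) (qDatum p)) :
    d 0 ≠ 0 ∧ d 1 = 0 ∧ d 2 = 3 := by
  have h := (dep_H'_and_not_S_iff p d).1 ⟨hH, hS⟩
  exact ⟨h.2.2, h.1, h.2.1⟩

/-- The zero-label artefact point `(1, 0, 3)`. [folklore] -/
def dZero : toyIndex.Label → ℕ := fun j => if j = 0 then 1 else if j = 2 then 3 else 0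

omit hp in
/-- Values of `dZero`. [folklore] -/
theorem dZero_vals : dZero 0 = 1 ∧ dZero 1 = 0 ∧ dZero 2 = 3 := by refine ⟨?_, ?_, ?_⟩ <;> decide

/-- **E3 (c): THE ZERO-LABEL ARTEFACT, exhibited.** At `d⃗ = (1, 0, 3)`: typed Thm 3.11 ∧ BridgeHyps ∧ `|log q| > 0` ∧ PinnedRegions3 ∧ `H′` ∧
Licence ∧ Statement HOLD and **S FAILS** — the failure sits at the zero label alone (`ρ(qK)_0 = 𝒪 ≠ p·𝒪 = ρ(Ψ)_0`… i.e. `B_0 ≠ B_{−1}`).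
A kernel model of «`H′ ∧` interface `∧ ¬S`», recorded WITH ITS LOCUS: it separates nothing at the labels that carry volume.
[claim: Mochizuki2012, status: disputed] -/
theorem E3_zero_label_artefact :
    (naiveFull p).Statement ∧ BridgeHyps (shellSettingDep p dZero) ∧ (shellSettingDep p dZero).AbsLogQPos ∧
    PinnedRegions3 (naiveFull p).toLatticeSituation (shellSettingDep p dZero) (rhoDep p dZero) (qDatum p) ∧
    H' (naiveFull p).toLatticeSituation (shellSettingDep p dZero) (rhoDep p dZero) (qDatum p) ∧
    Thm311ToCor312.Licence (shellSettingDep p dZero) ∧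
    Summit.ABC.IUTFork.Cor312.Setting.Statement (shellSettingDep p dZero) ∧
    ¬ PilotKummerIndRelated (naiveFull p).toLatticeSituation (shellSettingDep p dZero) (rhoDep p dZero) (qDatum p) ∧
    (∀ (i : Fin toyIndex.lstar) (vQ : toyIndex.VQ),
      (shellSettingDep p dZero).qRegion (Setting.labelSucc i) vQ ∈ (shellSettingDep p dZero).possibleImages (Setting.labelSucc i) vQ) := by
  have hv := dZero_vals
  refine ⟨naiveFull_statement p, dep_bridgeHyps p _, dep_absLogQPos p _, dep_pinnedRegions3 p _,
    (dep_H'_iff p _).2 ⟨hv.2.1, hv.2.2⟩, (dep_licence_iff p _).2 hv.2.2.ge, (dep_statement_iff p _).2 (by rw [hv.2.1, hv.2.2]),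
    fun h => ?_, fun i vQ => ?_⟩
  · have := ((dep_residual_iff p _).1 h).1
    rw [hv.1] at this
    exact one_ne_zero this
  · rw [dep_possibleImages, Set.mem_singleton_iff, dep_qRegion_labelSucc]
    rcases labelFin_cases i with rfl | rfl
    · rw [labelSucc_fin_zero, hv.2.1]; have : jsq (1 : toyIndex.Label) = 1 := by decide
      rw [this]; rfl
    · rw [labelSucc_fin_one, hv.2.2]; have : jsq (2 : toyIndex.Label) = 4 := by decide
      rw [this]; rfl

/-- **E3, packaged for the lead** (∃/∀ over the frozen interface; no verdict word written here): (1) there IS a pin-respecting model of typed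
Thm 3.11 with BridgeHyps, `|log q| > 0`, Step (x), label-independent q-volume, a non-identified q-datum, where `H′` (M32b) AND the residual S
hold (grade: SAT[ρ, label-dependent (Ind3)], honest except `hscaled` at `j = 2`); (2) on the label-dependent log-shell family every model of
`H′ ∧ ¬S` inflates the zero label. [claim: Mochizuki2012, status: disputed] -/
theorem E3_answer :
    (∃ (T : ThetaIndex) (F : FullSituation T) (P : Setting F.toLatticeSituation.toSituation)
        (ρ : (∀ v : T.V, v ∈ T.Vbad → Set (F.L.StarPacket v)) → ∀ (j : T.Label) (vQ : T.VQ), Set (F.L.Packet j vQ))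
        (qK : ∀ v : T.V, v ∈ T.Vbad → Set (F.L.StarPacket v)),
        F.Statement ∧ BridgeHyps P ∧ P.AbsLogQPos ∧ PinnedRegions3 F.toLatticeSituation P ρ qK ∧
        (∀ (i i' : Fin T.lstar) (vQ : T.VQ), P.qLocal (Setting.labelSucc i) vQ = P.qLocal (Setting.labelSucc i') vQ) ∧
        qK ≠ (F.toLatticeSituation.D P.n).Ψ ∧
        H' F.toLatticeSituation P ρ qK ∧ PilotKummerIndRelated F.toLatticeSituation P ρ qK ∧ P.Statement) ∧
    (∀ (p : ℕ) [Fact p.Prime] (d : toyIndex.Label → ℕ),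
        H' (naiveFull p).toLatticeSituation (shellSettingDep p d) (rhoDep p d) (qDatum p) →
        ¬ PilotKummerIndRelated (naiveFull p).toLatticeSituation (shellSettingDep p d) (rhoDep p d) (qDatum p) → d 0 ≠ 0) := by
  refine ⟨?_, fun p _ d hH hS => (E3_no_honest_separation p d hH hS).1⟩
  haveI : Fact (Nat.Prime 2) := ⟨Nat.prime_two⟩
  have h := E3_residual_witness 2
  exact ⟨toyIndex, naiveFull 2, shellSettingDep 2 dStar, rhoDep 2 dStar, qDatum 2, h.1, h.2.1, h.2.2.1, h.2.2.2.1,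
    h.2.2.2.2.2.2.2.1, h.2.2.2.2.2.2.2.2.2.2.2.2.2.1, h.2.2.2.2.2.2.2.2.1, h.2.2.2.2.2.2.2.2.2.2.1, h.2.2.2.2.2.2.2.2.2.2.2.2.1⟩

end Summit.ABC.IUTFork.Repair.ModelShellDep

end
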